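import Summits.QuantumFields.BalabanUV.T4Continuum.Support.DirichletDecoupledScattered
import Summits.QuantumFields.BalabanUV.T4Continuum.Support.DirichletScalarTowerPotential

/-!
# `BalabanUV.T4Continuum.Support.DirichletDecoupledPerturbed` — NE2 (node U1a) formalisation swarm, SUPPLIER item «Δ1-DECOUPLE» under the
# owner's sub-row `T4-U1a.S-NE2-D1-DIRICHLET°` (wall `hinj`), module (6): THE PERTURBED ∕ ZEROTH-ORDER TIERS OVER THE NEW CLASSES — for every
# set of unit blocks whose face-connected components are locally monotone (resp. coordinate boxes, resp. a scattered set) the owner's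
# injected binder `hinjS` is a THEOREM at rate `(√L)⁻¹` (resp. `L⁻¹`), so the resolvent route (`PerturbationLaws` displayed) and the
# zeroth-order potential tier (two DATA bounds displayed) run over these regions with NO free-tower binder
# (unit b2b-balaban-t4-ne2-formalise-leaf-08, gen 4, v1)

HONEST FRAMING.  Rung (B)+1 bookkeeping at MODEL level (U = 1 scalar layer `Δ′ = Δ + a′Π′` of [B9] (3.24) + a compressed perturbation
family ∕ a zeroth-order potential as DATA — the abelian-model level of tier A, not Bałaban's `Δ_a(U)`), finite torus; compositions BY NAME
of modules (4)∕(5) with the owner's `DirichletScalarTower.towerLimitRate_dirichletScalar_perturbed`, `DirichletScalarTowerLevels`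
(adapter) and `DirichletScalarTowerPotential.towerLimitRate_dirichletScalar_potential_of_injected` (t4-ne2-p1 gen 12) — NOT a new analytic
estimate; NE2 (U1a) is NOT proved by this file; Δ1 NOT closed; spine PROVED 0/9 unchanged; NOT infinite volume, NOT the mass gap, NOT Clay.
HONEST DEPENDENCY (verbatim): «continuum YM on T⁴ ⇐ BetaPertH ∧ nine spine estimates (0/9 proved); BetaPertH ⇐ (D1) ∧ (D4) ∧ CAP+tail;
G-an2-4 gates asym, D1 and NE2/3/4.»

WHAT THIS FILE PROVES (0 sorry), for the tower generated by `Ω₀ = blockReg (lev L 0) M S`: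
 * §1 `hinjS` AS A THEOREM on the classes: **`injected_le_components_monotone_lev`** (`≤ besovConst d a′ 6 48·√L·((√L)⁻¹)^k`),
   **`injected_le_components_box_lev`** (`≤ Cbox d L a′·(L⁻¹)^k`), `injected_le_scattered_lev`;
 * §2 THE RESOLVENT ROUTE over such regions: **`towerLimitRate_dirichletScalar_components_monotone_perturbed`** (rate `(√L)⁻¹`),
   **`towerLimitRate_dirichletScalar_components_box_perturbed`** and `…_scattered_perturbed` (rate `L⁻¹`) — only the perturbation
   family's `PerturbationLaws` and the coupling disc displayed besides `2 ≤ L`, `0 < d`, `0 < a′` and the class;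
 * §3 THE ZEROTH-ORDER POTENTIAL TIER: **`towerLimitRate_dirichletScalar_components_monotone_potential`** (rate `(√L)⁻¹`),
   **`towerLimitRate_dirichletScalar_components_box_potential`**, `…_scattered_potential` (rate `L⁻¹`) — displayed: the class, the two
   data bounds on `W` (with their signs), the coupling disc `‖t‖·αγ′⁻¹ < 1`; nothing else.

ABSOLUTE RULE (cell, verbatim): «No internally-minted statement may enter as a cited fact. Every hypothesis is either kernel-proved in
this package or a verbatim quotation of a PUBLISHED theorem with page reference. The manuscript(s) under audit are NOT citable for
their own disputed steps — they are the thing under adjudication; programme-internal (2001/route/tribunal) claims are never citable.»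
[folklore]; no `def … : Prop` fact; nothing printed is a hypothesis.  NOT CLAIMED: face-connected non-monotone components; Bałaban's
`Δ_a(U)` (B0); the VECTOR layer; NE2; NE3; «not in print; our proof».
-/

noncomputable section

open scoped BigOperators ComplexConjugate Matrix Matrix.Norms.L2Operator
open Filter Topology

namespace Summit.QuantumFields.BalabanUV.T4Continuum.DirichletDecoupledPerturbed

open Literature.MathematicalPhysics.QuantumFieldTheory.Balaban1983to89.B5Prop11Plancherel (Tor fine)
open Literature.MathematicalPhysics.QuantumFieldTheory.Balaban1983to89.B5G183RateUnitTower (lev lev_neZero)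
open Summit.QuantumFields.BalabanUV.T4Continuum
open Summit.QuantumFields.BalabanUV.T4Continuum.CovariantAveragingTower (TowerLimitRate)
open Summit.QuantumFields.BalabanUV.T4Continuum.BalabanAveragedTowerUnit (one_le_lev' cast_lev')
open Summit.QuantumFields.BalabanUV.T4Continuum.BalabanAveragedTowerModes (par)
open Summit.QuantumFields.BalabanUV.T4Continuum.BackgroundResolventTower
open Summit.QuantumFields.BalabanUV.T4Continuum.ScalarAveragedPropagator (gammaPs)
open Summit.QuantumFields.BalabanUV.T4Continuum.DirichletScalarTower
open Summit.QuantumFields.BalabanUV.T4Continuum.DirichletScalarTowerLevels (injected_regS_le_of_blockReg sqrt_lev invL_le_inv_sqrt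
  inv_sqrt_lt_one)
open Summit.QuantumFields.BalabanUV.T4Continuum.DirichletScalarTowerPotential (diagS towerLimitRate_dirichletScalar_potential_of_injected)
open Summit.QuantumFields.BalabanUV.T4Continuum.DirichletScalarTowerMonotone (two_le_mul_lev)
open Summit.QuantumFields.BalabanUV.T4Continuum.DirichletBesovTwoLevel (besovConst)
open Summit.QuantumFields.BalabanUV.T4Continuum.DirichletMonotoneCutoff (LocallyMonotone)
open Summit.QuantumFields.BalabanUV.T4Continuum.DirichletDecoupledComponents (faceGraphOn compOf injected_le_of_components_locallyMonotone
  injected_le_of_components_box)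
open Summit.QuantumFields.BalabanUV.T4Continuum.DirichletDecoupledScattered (Scattered isCoordBox_compOf_of_scattered)
open Summit.QuantumFields.BalabanUV.Beta.GAN24.DirichletBoxTrace (blockReg)
open Summit.QuantumFields.BalabanUV.Beta.GAN24.DirichletBoxCompression (DOm JOm refineR)
open Summit.QuantumFields.BalabanUV.Beta.GAN24.DirichletBoxTwoLevel (IsCoordBox Cbox)

variable {d : ℕ} (L : ℕ) [NeZero L] (M : Fin d → ℕ) [hM : ∀ μ, NeZero (M μ)] (a' : ℝ) (S : Tor M → Prop) [DecidablePred S]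

/-! ## §1 `hinjS` is a theorem on the classes -/

/-- **`hinjS` AT RATE `(√L)⁻¹` FOR A BLOCK SET WITH LOCALLY MONOTONE FACE-CONNECTED COMPONENTS** (`L ≥ 2`, `a′ > 0`). [folklore] -/
theorem injected_le_components_monotone_lev (hL : 2 ≤ L) (ha' : 0 < a') (hcomp : ∀ c, LocallyMonotone M (compOf M S c)) (k : ℕ) :
    ‖(DsR L M a' (blockReg (lev L 0) M S) (k + 1))⁻¹ * JsR L M (blockReg (lev L 0) M S) k
        - JsR L M (blockReg (lev L 0) M S) k * (DsR L M a' (blockReg (lev L 0) M S) k)⁻¹‖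
      ≤ besovConst d a' 6 48 * Real.sqrt (L : ℝ) * (Real.sqrt (L : ℝ))⁻¹ ^ k := by
  have h := injected_regS_le_of_blockReg L M a' S (fun k => injected_le_of_components_locallyMonotone S (lev L k) L a' hcomp
    (one_le_lev' L k) (two_le_mul_lev L hL k) ha') k
  rw [sqrt_lev, div_eq_mul_inv, ← inv_pow] at h
  exact h

/-- **`hinjS` AT THE FULL RATE `L⁻¹` FOR A BLOCK SET WITH BOX COMPONENTS** (`a′ > 0`). [folklore] -/
theorem injected_le_components_box_lev (ha' : 0 < a') (hcomp : ∀ c, IsCoordBox M (compOf M S c)) (k : ℕ) :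
    ‖(DsR L M a' (blockReg (lev L 0) M S) (k + 1))⁻¹ * JsR L M (blockReg (lev L 0) M S) k
        - JsR L M (blockReg (lev L 0) M S) k * (DsR L M a' (blockReg (lev L 0) M S) k)⁻¹‖ ≤ Cbox d L a' * ((L : ℝ)⁻¹) ^ k := by
  have h := injected_regS_le_of_blockReg L M a' S (fun k => injected_le_of_components_box S (lev L k) L a' hcomp (one_le_lev' L k) ha') k
  rw [cast_lev', div_eq_mul_inv, ← inv_pow] at h
  exact h

/-- `hinjS` at the full rate `L⁻¹` for a SCATTERED block set. [folklore] -/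
theorem injected_le_scattered_lev (ha' : 0 < a') (h : Scattered M S) (k : ℕ) :
    ‖(DsR L M a' (blockReg (lev L 0) M S) (k + 1))⁻¹ * JsR L M (blockReg (lev L 0) M S) k
        - JsR L M (blockReg (lev L 0) M S) k * (DsR L M a' (blockReg (lev L 0) M S) k)⁻¹‖ ≤ Cbox d L a' * ((L : ℝ)⁻¹) ^ k :=
  injected_le_components_box_lev L M a' S ha' (isCoordBox_compOf_of_scattered h) k

/-! ## §2 The resolvent route over the classes -/

section Perturbed

variable {P : (k : ℕ) → Matrix (sidx L M (blockReg (lev L 0) M S) k) (sidx L M (blockReg (lev L 0) M S) k) ℂ} {κ C₂ : ℝ} {t : ℂ}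

/-- **THE RESOLVENT ROUTE OVER A BLOCK SET WITH LOCALLY MONOTONE FACE-CONNECTED COMPONENTS** (`L ≥ 2`, `d ≥ 1`, `a′ > 0`): for every
compressed perturbation family with `PerturbationLaws (DsR …) P (JsR …) κ (k ↦ C₂(√L)^{−k})` and `‖t‖κ < 1`, the Ω-restricted perturbed
scalar covariances converge at rate `(√L)⁻¹` — the free-tower input is a THEOREM. [folklore] -/
theorem towerLimitRate_dirichletScalar_components_monotone_perturbed (hL : 2 ≤ L) (hd : 0 < d) (ha' : 0 < a')
    (hcomp : ∀ c, LocallyMonotone M (compOf M S c))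
    (hpert : PerturbationLaws (DsR L M a' (blockReg (lev L 0) M S)) P (JsR L M (blockReg (lev L 0) M S)) κ
      (fun k => C₂ * ((Real.sqrt (L : ℝ))⁻¹) ^ k)) (ht : ‖t‖ * κ < 1) :
    TowerLimitRate (QsR L M (blockReg (lev L 0) M S)) ((L : ℝ) ^ d) (fun k => (DsR L M a' (blockReg (lev L 0) M S) k + t • P k)⁻¹)
      (Cpert κ (2 * d * Real.sqrt ((gammaPs d a')⁻¹)) (besovConst d a' 6 48 * Real.sqrt (L : ℝ)) C₂ 0 t) ((Real.sqrt (L : ℝ))⁻¹) :=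
  towerLimitRate_dirichletScalar_perturbed L M a' (blockReg (lev L 0) M S) hd ha' (invL_le_inv_sqrt L (le_trans one_le_two hL))
    (inv_sqrt_lt_one L hL) (injected_le_components_monotone_lev L M a' S hL ha' hcomp) hpert ht

/-- **THE RESOLVENT ROUTE OVER A BLOCK SET WITH BOX COMPONENTS**, rate `L⁻¹`. [folklore] -/
theorem towerLimitRate_dirichletScalar_components_box_perturbed (hL : 2 ≤ L) (hd : 0 < d) (ha' : 0 < a')
    (hcomp : ∀ c, IsCoordBox M (compOf M S c))
    (hpert : PerturbationLaws (DsR L M a' (blockReg (lev L 0) M S)) P (JsR L M (blockReg (lev L 0) M S)) κ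
      (fun k => C₂ * ((L : ℝ)⁻¹) ^ k)) (ht : ‖t‖ * κ < 1) :
    TowerLimitRate (QsR L M (blockReg (lev L 0) M S)) ((L : ℝ) ^ d) (fun k => (DsR L M a' (blockReg (lev L 0) M S) k + t • P k)⁻¹)
      (Cpert κ (2 * d * Real.sqrt ((gammaPs d a')⁻¹)) (Cbox d L a') C₂ 0 t) ((L : ℝ)⁻¹) :=
  towerLimitRate_dirichletScalar_perturbed L M a' (blockReg (lev L 0) M S) hd ha' le_rfl (inv_lt_one_of_one_lt₀ (by exact_mod_cast (lt_of_lt_of_le one_lt_two hL : 1 < L)))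
    (injected_le_components_box_lev L M a' S ha' hcomp) hpert ht

/-- the resolvent route over a SCATTERED block set, rate `L⁻¹`. [folklore] -/
theorem towerLimitRate_dirichletScalar_scattered_perturbed (hL : 2 ≤ L) (hd : 0 < d) (ha' : 0 < a') (h : Scattered M S)
    (hpert : PerturbationLaws (DsR L M a' (blockReg (lev L 0) M S)) P (JsR L M (blockReg (lev L 0) M S)) κ
      (fun k => C₂ * ((L : ℝ)⁻¹) ^ k)) (ht : ‖t‖ * κ < 1) :
    TowerLimitRate (QsR L M (blockReg (lev L 0) M S)) ((L : ℝ) ^ d) (fun k => (DsR L M a' (blockReg (lev L 0) M S) k + t • P k)⁻¹)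
      (Cpert κ (2 * d * Real.sqrt ((gammaPs d a')⁻¹)) (Cbox d L a') C₂ 0 t) ((L : ℝ)⁻¹) :=
  towerLimitRate_dirichletScalar_components_box_perturbed L M a' S hL hd ha' (isCoordBox_compOf_of_scattered h) hpert ht

end Perturbed

/-! ## §3 The zeroth-order potential tier over the classes -/

section Potential

variable {W : (k : ℕ) → (Tor (fine (lev L k) M) → ℂ)} {α β : ℝ} {t : ℂ}

/-- **THE ZEROTH-ORDER TIER OVER A BLOCK SET WITH LOCALLY MONOTONE FACE-CONNECTED COMPONENTS — NO FREE-TOWER BINDER** (`L ≥ 2`, `d ≥ 1`,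
`a′ > 0`): for a potential family with `‖W^{(k)}(x)‖ ≤ α`, `‖W^{(k+1)}(y) − W^{(k)}(par y)‖ ≤ β/n_k` and a coupling `‖t‖·αγ′⁻¹ < 1`, the
unit-lattice covariances of `(Ω₀(−Δ + a′Π′)Ω₀ + t·diag(W^{(k)})_{ΩΩ})⁻¹` converge at rate `(√L)⁻¹`. [folklore] -/
theorem towerLimitRate_dirichletScalar_components_monotone_potential (hL : 2 ≤ L) (hd : 0 < d) (ha' : 0 < a')
    (hcomp : ∀ c, LocallyMonotone M (compOf M S c)) (hα : 0 ≤ α) (hβ : 0 ≤ β) (hW : ∀ k x, ‖W k x‖ ≤ α)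
    (hW' : ∀ k (y : Tor (fine (lev L (k + 1)) M)), ‖W (k + 1) y - W k (par (lev L k) L M y)‖ ≤ β / (lev L k : ℕ))
    (ht : ‖t‖ * (α * (gammaPs d a')⁻¹) < 1) :
    TowerLimitRate (QsR L M (blockReg (lev L 0) M S)) ((L : ℝ) ^ d)
      (fun k => (DsR L M a' (blockReg (lev L 0) M S) k + t • diagS L M (blockReg (lev L 0) M S) W k)⁻¹)
      (Cpert (α * (gammaPs d a')⁻¹) (2 * d * Real.sqrt ((gammaPs d a')⁻¹)) (besovConst d a' 6 48 * Real.sqrt (L : ℝ))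
        ((gammaPs d a')⁻¹ * β * (gammaPs d a')⁻¹) 0 t) ((Real.sqrt (L : ℝ))⁻¹) :=
  towerLimitRate_dirichletScalar_potential_of_injected L M a' (blockReg (lev L 0) M S) hd ha'
    (invL_le_inv_sqrt L (le_trans one_le_two hL)) (inv_sqrt_lt_one L hL) (injected_le_components_monotone_lev L M a' S hL ha' hcomp)
    hα hβ hW hW' ht

/-- **THE ZEROTH-ORDER TIER OVER A BLOCK SET WITH BOX COMPONENTS**, rate `L⁻¹`, no free-tower binder. [folklore] -/
theorem towerLimitRate_dirichletScalar_components_box_potential (hL : 2 ≤ L) (hd : 0 < d) (ha' : 0 < a')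
    (hcomp : ∀ c, IsCoordBox M (compOf M S c)) (hα : 0 ≤ α) (hβ : 0 ≤ β) (hW : ∀ k x, ‖W k x‖ ≤ α)
    (hW' : ∀ k (y : Tor (fine (lev L (k + 1)) M)), ‖W (k + 1) y - W k (par (lev L k) L M y)‖ ≤ β / (lev L k : ℕ))
    (ht : ‖t‖ * (α * (gammaPs d a')⁻¹) < 1) :
    TowerLimitRate (QsR L M (blockReg (lev L 0) M S)) ((L : ℝ) ^ d)
      (fun k => (DsR L M a' (blockReg (lev L 0) M S) k + t • diagS L M (blockReg (lev L 0) M S) W k)⁻¹)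
      (Cpert (α * (gammaPs d a')⁻¹) (2 * d * Real.sqrt ((gammaPs d a')⁻¹)) (Cbox d L a')
        ((gammaPs d a')⁻¹ * β * (gammaPs d a')⁻¹) 0 t) ((L : ℝ)⁻¹) :=
  towerLimitRate_dirichletScalar_potential_of_injected L M a' (blockReg (lev L 0) M S) hd ha' le_rfl (inv_lt_one_of_one_lt₀ (by exact_mod_cast (lt_of_lt_of_le one_lt_two hL : 1 < L)))
    (injected_le_components_box_lev L M a' S ha' hcomp) hα hβ hW hW' ht

/-- the zeroth-order tier over a SCATTERED block set, rate `L⁻¹`, no free-tower binder. [folklore] -/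
theorem towerLimitRate_dirichletScalar_scattered_potential (hL : 2 ≤ L) (hd : 0 < d) (ha' : 0 < a') (h : Scattered M S)
    (hα : 0 ≤ α) (hβ : 0 ≤ β) (hW : ∀ k x, ‖W k x‖ ≤ α)
    (hW' : ∀ k (y : Tor (fine (lev L (k + 1)) M)), ‖W (k + 1) y - W k (par (lev L k) L M y)‖ ≤ β / (lev L k : ℕ))
    (ht : ‖t‖ * (α * (gammaPs d a')⁻¹) < 1) :
    TowerLimitRate (QsR L M (blockReg (lev L 0) M S)) ((L : ℝ) ^ d)
      (fun k => (DsR L M a' (blockReg (lev L 0) M S) k + t • diagS L M (blockReg (lev L 0) M S) W k)⁻¹)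
      (Cpert (α * (gammaPs d a')⁻¹) (2 * d * Real.sqrt ((gammaPs d a')⁻¹)) (Cbox d L a')
        ((gammaPs d a')⁻¹ * β * (gammaPs d a')⁻¹) 0 t) ((L : ℝ)⁻¹) :=
  towerLimitRate_dirichletScalar_components_box_potential L M a' S hL hd ha' (isCoordBox_compOf_of_scattered h) hα hβ hW hW' ht

end Potential

end Summit.QuantumFields.BalabanUV.T4Continuum.DirichletDecoupledPerturbed

end
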